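import Mathlib
import HarnessLib
import HarnessLib.Audit
import Summits.AnomalousDissipation.Statement
import Literature.Analysis.FluidPDE.StatisticalSolution
import Literature.Analysis.FluidPDE.StationaryLerayHopfLaw
import Literature.Analysis.FunctionSpaces.TorusFluidGlue
import Literature.Analysis.FunctionSpaces.TorusSobolevSpace
import HarnessLib.Audit.Status.Attr

/-!
Route: ErgodicMirrorGate

# Route ErgodicMirrorGate — Ergodic mirror gate at f_TG — the bounded mirror family, an ergodic
tame-or-loud climate gap and no Eulerian-limit climate give the zeroth law

decomp-ad cell (HOME = run/shared/lean/pub/decomp-ad), lens-6 g17 NODE «ErgodicMirrorGate» (lens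
«barrier-complement carving»; OR-SIBLING #3 of the Taylor–Green MIRROR SHELF after SteadyMirrorGate
g15 (filed, DRAFT r0) and CoherentMirrorGate g16 (cleared, filing deferred-conditional)), critic
«CLEARED» MODERATE decomp-ad-crit-1 g3 2026-08-30T15:44:23Z (by-name certificate
ChkEMG_g17_byname.lean 7aaad103b677: closes by name, B ↔ 17694 and F ↔ 24257/33835 by Iff.rfl, X_K →
B; typing audit symbol by symbol; FILE NOW); kernel node
HOME/decomp-ad-lens-6/g17/ErgodicMirrorGate.lean sha256
279c28b389cc29b5a290a673a795e68accf22788ec845954ead8170883c94db8 (348 l.) — lean check rc 0 · 0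
errors · 0 warnings · 0 sorry · axioms(closes) = propext/Classical.choice/Quot.sound; card
HOME/decomp-ad-lens-6/g17/ErgodicMirrorGate_NODE.md c6c2d0ce2f0d; probes
HOME/decomp-ad-lens-6/g17/ErgodicMirrorGate_probe.lean 50c4d878014a + _probe.out.txt 91fcf0dc6cbd
(6/6 #h21_crux_probe CLEAN; P3 timeouts on N_stat/KB/T/R_stat). WRITER TYPING: the kernel's item
signatures are already self-contained one-liners in the shelf convention `∀ f, f = (TG lambda) → …`
(no hinge definitions); the writer only dropped the kernel's `import …Theses.MirrorEnsemble` (used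
there for by-name certificates) and re-checked defs + `closes` verbatim in a MirrorEnsemble-free
sketch (SketchEMGW.lean rc 0 · 0 err · 0 sorry). It suffices to show X = B ∧ G_erg ∧ N_stat at the
PINNED Taylor–Green force f_TG inside the MIRROR CLASS Fix K (coordinatewise odd under x_i ↦ −x_i,
a.e., every time): (B) MirrorMeanBoundedFamilyTG — BY NAME the tree item
stmt-AnomalousDissipation-17694 (MirrorEnsemble's crux, byte-identical signature ⇒ the gate attaches
this route; NO new ∃-item): mean-bounded K-symmetric global Leray–Hopf solutions u_j of
NS_{ν_j}(f_TG), ν_j → 0, ANY time dependence — the bare hard core of the pinned branch, NECESSARY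
for the mirror zeroth law X_K 17692 (projection proved in the kernel), so the ∃-dial {steady ⊂
coherent ⊂ arbitrary} of the shelf is CLOSED at its necessary end; (G_erg) MirrorClimateGapTG — ∀E
∃M ε>0 ∀ν>0: every ERGODIC stationary Leray–Hopf trajectory law of NS_ν(f_TG) (tree format
`Torus.IsStationaryLerayHopfLaw` + Mathlib `Ergodic`) with K-symmetric paths, measurable unit-block
energy/enstrophy e, z (lower integrals, no Bochner junk) and E_P[e] ≤ E is TAME (E_P[z] ≤ M) or LOUD
(ν·E_P[z] ≥ ε) — no bounded ergodic K-climate is rough-and-quiet; (N_stat) NoMirrorEulerClimateTG —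
∀E M: f_TG carries NO stationary law (P probability, S P-preserving intertwining the unit shift, e z
measurable) on K-symmetric weak EULER paths (`Torus.IsWeakNSSolutionForcedOn T 0 (fun _ => f_TG)
(traj ω 0) (traj ω)` for all T) with E[e] ≤ E, E[z] ≤ M — no Eulerian-limit climate in the pumped
mirror class. With the theorem-grade supports KB (ErgodicClimateTG: Krylov–Bogoliubov on path space
+ ergodic decomposition + Birkhoff — each datum of B yields an ERGODIC bounded K-climate at the same
ν with E[e] ≤ E, E[z] < ∞ AND a generic path ω₀ with meanEnergy ≤ E and meanDissipation = ν·E_P[z]: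
REALISATION IS FREE in trajectory currency), T (TameClimateLimitTG: Eulerian limit IN LAW of tame
bounded stationary K-climates as ν_n → 0 — Prokhorov + Skorokhod + Aubin–Lions–Simon,
Kuksin–Shirikyan Thm 5.2.2 model) and F (= 24257/15378, closed), ROOT ⟸ X by sixty lines of logic
(`closes`, kernel-checked): per index n, KB + G_erg give «loud generic path at ν_n» or «tame ergodic
K-climate at ν_n»; loud frequently ⇒ the generic paths along an extraction ARE the ZerothLaw tuple
(E from B, ε from G_erg, ENNReal → ℝ conversion with E_P[z] < ∞); tame eventually ⇒ T lands the tail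
on a stationary Euler climate of f_TG in Fix K with finite mean enstrophy ⇒ N_stat ⊥. Target = ROOT
`_root_.AnomalousDissipation`; one layer, no EQUIV item, no residual (open = [B (instrumented G5
core), G_erg, N_stat]; B ∧ G_erg ⇏ S (W_tame-stat), B ∧ N_stat ⇏ S (W_PB-stat), G_erg ∧ N_stat ⇏ S
(W_fat)).
Lean:
`Summit.AnomalousDissipation.AnomalousDissipation.Theses.ErgodicMirrorGate.MirrorMeanBoundedFamilyTG
∧ Summit.AnomalousDissipation.AnomalousDissipation.Theses.ErgodicMirrorGate.MirrorClimateGapTG ∧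
Summit.AnomalousDissipation.AnomalousDissipation.Theses.ErgodicMirrorGate.NoMirrorEulerClimateTG`

## Assembly
Sixty lines of logic, kernel-checked in the lens file and re-checked verbatim in the writer's
MirrorEnsemble-free sketch as `closes (hB hG hN hKB hT hF)`: name f_TG (`obtain ⟨f, hf⟩ : ∃ f, f =
TG := ⟨_, rfl⟩`); F gives the force clauses; B gives (E, ν, u₀, u, U) with the mirror clauses and
mean energy ≤ E; G_erg at level E gives (M, ε); `key n`: KB on the n-th datum → an ergodic bounded
K-climate + generic path ω₀; G_erg → tame ∨ loud; loud ⇒ a root-currency witness at index n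
(meanEnergy (traj ω₀) ≤ E, meanDissipation = ν_n·(E_P[z]).toReal ≥ ε by `ENNReal.mul_ne_top` /
`toReal_mono` / `toReal_ofReal` / `toReal_mul`, using E_P[z] ≠ ⊤ from KB); `by_cases ∃ᶠ n, loud n`:
frequently ⇒ `Filter.extraction_of_frequently_atTop` φ, `choose`, and the ZerothLaw tuple is (f_TG,
ν ∘ φ, v₀, v, E, ε); not frequently ⇒ eventually tame from some J (`Filter.not_frequently`,
`eventually_atTop`), T on the shifted tail (ν (j+J) → 0 by `tendsto_add_atTop_iff_nat`) gives a
stationary Euler climate with bounds (E', M') ⇒ `(hN … ).elim`.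

Rationale: WHY THIS LINE. The shelf's two earlier gates put the ∃-piece on STEADY states (SMG C_s 33830) or
COHERENT states (CMG C_coh) — witness classes the mirror zeroth law X_K (MirrorEnsemble 17692) does
NOT give back — and the tree's statistical attacks put LOUDNESS either into a universal floor over
phase-space statistical solutions (MirrorEnsemble L_K 17693, census WK3 near-costume;
EnsembleRigidity / TameRoughRigidity at f_GP, whose moment constraints Reynolds stresses absorb —
lens-3 g13 B2 «statistical gates are inhabited») or into the ∃-piece (Ensemble 0214 +
summit-strength EnsembleRealization 0215; QuietRigidity's posited law with a rigidity crux, CLOSED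
as costume). This line re-types the (Q)-gate over ERGODIC TRAJECTORY LAWS: (i) the ∃-piece is
dialled DOWN to the branch's necessary hard core B = 17694 verbatim (shared with the dormant
MirrorEnsemble; priced by the EXISTING census currency WK4/IN7 instead of a new K-UPO instrument);
(ii) laws are never POSITED, they are EXTRACTED (KB: Krylov–Bogoliubov time-average measures of
Foias–Rosa–Temam [FoiasRosaTemam2010 Def. 3.2; arXiv:1606.02174; FMRTTurbulence2001 Ch. IV §1] +
ergodic decomposition + Birkhoff), which is exactly where REALISATION becomes a theorem: the
zeroth-law witness of the loud horn is a generic trajectory of the loud ergodic component of u_j's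
climate — what Ensemble's 0215 lacked; (iii) ERGODIC typing of the rate gap is necessary, not
decorative (world W_mix: one trajectory's statistics may mix a tame and a loud component with any
weights, so a trajectory-wise dichotomy with uniform constants is FALSE while G_erg holds); (iv) the
inviscid exclusion N_stat quantifies over laws CARRIED BY EXACT WEAK EULER PATHS (inhabited only by
honest Euler solutions — not a moment gate), and its smooth sub-class is DECIDED by the statistical
KELVIN CLOCK (Γ_C(t) = Γ_C(0) + 4t/π along every C¹ K-symmetric Euler path contradicts stationarity
— rung R_stat, provable now, NOT an item: Negative lane of N_stat). Imported with an explicit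
dictionary: 2-D stochastic turbulence (Kuksin's EULERIAN LIMIT [KuksinShirikyan2012 Thm 5.2.2, Cor.
5.2.3] transplanted to deterministic 3-D tame laws as T, with the OPPOSITE expected outcome because
the 3-D Fix-K limit keeps the O(1) steady pump), trajectory statistical solutions (arXiv:1406.2600;
doi:10.1007/BF01192467), ergodic theory (Mathlib `Ergodic`). Siblings: ∃-pieces C_s ⇒ C_coh ⇒ B (B
the end of the dial); ∀-pieces G ⇐ G_coh ⇐ G_erg, N ⇐ N_coh ⇐ N_stat (each strictly STRONGER here —
declared); supports: Rellich on states/orbits → Krylov–Bogoliubov/Prokhorov on laws. Critic's rule: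
EMG is the designated survivor of an SMG kill on C_s; CMG's trigger (ii) is superseded.

RANKED CRUXES. #2 MirrorMeanBoundedFamilyTG (crux) — [crux, B «MEAN-BOUNDED MIRROR FAMILY»; = BY
NAME stmt-AnomalousDissipation-17694 (MirrorEnsemble's crux 2, dormant route; byte-identical
signature, writer-verified ⇒ DEDUP: the gate attaches this route to 17694 — no twin ∃-item); TAG
UNDECIDED(INSTRUMENTED, price only, G8(iii): census WK4/IN7 — every K-symmetric from-rest DNS at r ∈
{1/16,…,1/512} BOUNDED, envelope 0.67–0.70 flat, ⟨E⟩ = 0.46 at r = 1/64; tribunal-named instrument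
of the SMG lineage = one more decade r = 1/1024, 1/2048); LEAF: INSTRUMENTABLE + IDEA-NEEDED (G5
declared: a ν-uniform mean-energy bound for ONE fixed 3-D force is the registered hard core 15509 in
its Fix-K/f_TG instance; printed open even in 2-D, arXiv:1305.7089 p. 3); NECESSARY for X_K 17692
(kernel `boundedFamily_of_mirrorZerothLaw`) — unlike C_s 33830 / C_coh: the ∃-dial is CLOSED at its
necessary end; incomparable with S (B ⇏ S: no loudness; S ⇏ B); crit CLEARED MODERATE 15:44:23Z] At
the pinned Taylor–Green force there are E, viscosities ν_j > 0 → 0, data and global Leray–Hopf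
solutions u_j of NS_{ν_j}(f_TG) whose H-lifts U_j (U_j t = u_j t in L² for every t ≥ 0) stay in the
mirror class Fix K (coordinatewise odd a.e., every t ≥ 0) with meanEnergy u_j ≤ E for all j. KILL: a
growing from-rest envelope E ≍ ν^{-α} in the K-symmetric DNS decade r = 1/1024, 1/2048 (prices B
dead; a theorem needs a fattening mechanism for EVERY K-family). [difficulty: open-problem] (why it
might fail: every K-family may fatten in the mean as ν → 0 (E ≍ ν^{-α}: capture by near-laminar
layered states; the steady K-branches of the Newton census run away like E ~ ν^{-0.7} beyond the
fold) — turbulent saturation may simply fail at f_TG in Fix K.) [DoeringFoias2002,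
FMRTTurbulence2001, arXiv:2311.04182, arXiv:1305.7089, doi:10.1017/s0022112083001159]
#3 MirrorClimateGapTG (crux) — [crux, G_erg «MIRROR CLIMATE RATE GAP» (the rough-quiet horn excluded
over ERGODIC statistics); TAG UNDECIDED(INSTRUMENTED, price only: the from-rest K-runs ARE
approximants of ergodic K-climates and sit in the LOUD alternative, ⟨D⟩ = 0.26 flat on r =
1/32…1/64, running mean ≥ 0.15 on r ≤ 1/32 (IN7); kill signal = window-mean enstrophy slope s(ν) = d
log⟨‖∇u‖²⟩/d log(1/ν) persistently in (0,1) along a bounded K-climate family, e.g. Prandtl–Batchelor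
s = 1/2; 0-core-h PILOT endorsed first (see Cheapest falsifier); T-CLIMATE (≈ 95 core-h per run, ≤ 2
within cap) only after it); LEAF: IDEA-NEEDED (no a-priori rate gap for stationary statistics is
known) + INSTRUMENTABLE; large ν free (ν E_P[z] ≤ ‖f_TG‖√E); ERGODIC typing essential (W_mix: a
trajectory mixing tame and loud components has ν⟨z⟩ = θε, any value — no trajectory-wise uniform
dichotomy holds, while every ergodic component is realised by its own generic path); STRONGER than
CMG's G_coh ⊋ SMG's G 33831 (Dirac / uniform-phase laws of K-steady states / K-periodic orbits are
ergodic climates with E_P[z] = period-mean enstrophy) — declared; not a floor (vacuous in fat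
worlds, satisfied by tame worlds); consumed by `closes` only on the climates KB extracts from B's
family (fallback G_fam recorded); mechanism distinct from N_stat (boundary-layer RATE exclusion vs
inviscid-CLIMATE exclusion, E13(i)), neither half free; strictly weaker than S (vacuous in W_fat,
true in W_tame-stat; G_erg ⇏ S, G_erg ∧ N_stat ⇏ S, S ⇏ G_erg); crit CLEARED MODERATE 15:44:23Z] At
the pinned force, for every E there are M and ε > 0 such that for every ν > 0, every ERGODIC
stationary Leray–Hopf trajectory law (Ω, P, S, traj) of NS_ν(f_TG) (tree
`Torus.IsStationaryLerayHopfLaw` + Mathlib `Ergodic S P`) with K-symmetric paths (coordinatewise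
a.e., every time), measurable unit-block energy e(ω) = ∫₀¹∫|traj ω s|² and enstrophy z(ω) = ∫₀¹
eGradNormSq(traj ω s) (lower integrals) and E_P[e] ≤ E is EITHER tame (E_P[z] ≤ M) OR loud (ν·E_P[z]
≥ ε). KILL: a bounded K-climate family with E_P[z] ≍ ν^{-β}, 0 < β < 1 (a K-symmetric
Prandtl–Batchelor climate; a condensate-type saturation à la Gallet–Young). [difficulty:
open-problem] (why it might fail: W_PB-stat: K-symmetric Prandtl–Batchelor CLIMATES (free layers of
width √ν, O(1) jumps, E_P[z] ≍ ν^{-1/2}, ν E_P[z] → 0 at bounded energy; CKG 2001, AD06 in 2-D) or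
weakly-chaotic bounded K-climates dissipating like ν^β, 0<β<1 (Gallet–Young 2013) — nothing excludes
either in 3-D Fix K.) [ChildressKerswellGilbert2001, doi:10.1017/S0022112056000123,
doi:10.1017/jfm.2012.524, FoiasRosaTemam2010, arXiv:1606.02174, AlexakisDoering2006]
#4 NoMirrorEulerClimateTG (crux) — [crux, N_stat «NO EULERIAN-LIMIT CLIMATE IN THE PUMPED MIRROR
CLASS» = NO(Q) of the E7c record lifted from roots / orbits to STATIONARY LAWS carried by exact weak
Euler paths, made LOAD-BEARING; TAG UNDECIDED(E7c programme prices its steady members: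
CarrierAnatomy N1/N2, EdgeCusp N7–N10 — pumped separable edges force the cusp exponent α⋆ =
0.444665, class ceiling H^s, s < 1.1156, H¹ NOT excluded; census: every computed K-climate is LOUD,
none tame — no Eulerian-limit climate in sight numerically); LEAF: IDEA-NEEDED + BARRIER-COMPLEMENT
(the statement that QuietRootFloorBarrier's alternative is VOID on tame K-STATISTICS at f_TG; its
SMOOTH sub-class is DECIDED by the statistical KELVIN CLOCK — skeleton loop C = ∂([0,½]²×{x₂=0}),
Γ_C(t) = Γ_C(0) + 4t/π along every C¹ K-symmetric Euler path of f_TG, and a measurable observable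
growing linearly along EVERY path contradicts stationarity: rung R_stat `NoSmoothMirrorClimateTG`,
provable now M–L, deliberately NOT a route item (not in cone) — Negative lane
`Theorems/NoMirrorEulerClimateTG/Negative/NoSmoothMirrorClimateTG.lean --supports <this item>`;
crit's optional trace-ladder rung (H^{1+δ} climates) likewise); MODEL WITH THE OPPOSITE OUTCOME:
Kuksin's 2-D stochastic Eulerian limit (limit measures invariant for FREE Euler) — in 3-D Fix K the
limit keeps the O(1) pump injecting circulation 4/π per unit time on the skeleton; STRONGER than
CMG's N_coh ⊋ SMG's N 33832 (Diracs on H¹ K-roots of (Q), uniform-phase laws of tame K-periodic weak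
Euler orbits are such laws) — declared; refutable by ANY tame K-Euler climate; no cheap
energy-balance attack (L^∞L² ∩ L²H¹ below L³_t B^{1/3}_3) and no construction threat (convex
integration ≪ H¹); ergodicity NOT assumed (T's limits need not be ergodic); consumed by `closes`
only through T (N_stat,visc = fallback); lens-3 g13 B2 inapplicable (laws on exact weak Euler PATHS,
not moment solutions); strictly weaker than S (N_stat ⇏ S: W_fat, W_PB-stat; S ⇏ N_stat); crit
CLEARED MODERATE 15:44:23Z] At the pinned force, for all E, M there is NO stationary law (Ω, P, S,
traj) — P a probability measure, S P-preserving with traj (S ω) t = traj ω (t+1), block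
energy/enstrophy measurable — whose paths are K-symmetric (coordinatewise a.e., every time) weak
solutions of the Euler equations forced by f_TG from their own time-0 slice on every [0,T)
(`Torus.IsWeakNSSolutionForcedOn T 0 (fun _ => f_TG) (traj ω 0) (traj ω)`), with E_P[e] ≤ E and
E_P[z] ≤ M. KILL: any H¹ K-symmetric steady root of (Q) (EdgeCusp N13 lane), any tame K-periodic
weak Euler orbit of f_TG, or a DNS family whose window-mean enstrophy SATURATES as ν ↓ (s = 0,
Eulerian-limit signal). [difficulty: open-problem] (why it might fail: an H¹ K-symmetric steady root
of (Q) with pumped edge cusps closing up globally (EdgeCusp N13), or an intermittent H¹ dissipative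
Euler CLIMATE absorbing the pump's power by anomalous dissipation — energy balance for L^∞L² ∩ L²H¹
weak Euler paths is open, so no balance law excludes it cheaply.) [KuksinShirikyan2012,
doi:10.1017/cbo9781139137119, arXiv:1409.4322, arXiv:2203.13115, DuchonRobert2000,
doi:10.1357/002224004774201681]
#9 ErgodicClimateTG (support) — [support, KB «ERGODIC CLIMATE OF A BOUNDED PATH»; TAG
WEAKER·THEOREM-GRADE XL (Krylov–Bogoliubov on two-sided path space X = C_loc(H_w) ∩ L²_loc-strong:
window enstrophy bounds from the strong energy inequality at a.e. time
(`IsLerayHopfOn.energy_ineq_ae`) ⇒ Aubin–Lions–Simon tightness; the Leray–Hopf class is closed at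
fixed ν > 0 and one restricts to the invariant full-measure set where EVERY path is Leray–Hopf from
its own slice (the tree format asks every path); E_P̄[e] ≤ meanEnergy ≤ E by portmanteau, E_P̄[z] ≤
liminf by lower semicontinuity; ergodic decomposition on a standard Borel space ⇒ a component with
E[e] ≤ E, E[z] < ∞; a Birkhoff-generic point + integer-block sandwich ⇒ the root's limsup
functionals meanEnergy / meanDissipation are honest limits; print: Vishik–Fursikov / time-average
measures [corpus:paper:foias2010-note-statistical-solutions-three-dimensional-navierstokes-equations
pp. 3–6], arXiv:1606.02174, [corpus:book:foias2001-navier-stokes-equations-turbulence pp. 188, 208];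
tree: `Torus.IsStationaryLerayHopfLaw` (+ `of_steady`), Birkhoff in `Literature.Dynamics.Ergodic`);
LEAF: ATTACKABLE NOW (XL; splittable by the planner into KB₁ Krylov–Bogoliubov law / KB₂ ergodic
component / KB₃ generic path — one item at birth per the critic); REALISATION IS FREE: the loud
horn's witness is a generic trajectory of the loud ergodic component of u's climate — what
Ensemble's EnsembleRealization 0215 (summit-strength) lacked; in cone; strictly weaker than S
(statistics at FIXED ν > 0)] For the pinned force, ν > 0 and ONE global Leray–Hopf solution u of
NS_ν(f_TG) whose H-lift is K-symmetric for t ≥ 0 with meanEnergy u ≤ E (exactly a datum of B), there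
is an ERGODIC stationary Leray–Hopf trajectory law (Ω, P, S, traj) of NS_ν(f_TG) with K-symmetric
paths, measurable block functionals, E_P[e] ≤ E, E_P[z] < ∞, AND a path ω₀ with meanEnergy (traj ω₀)
≤ E and meanDissipation ν (traj ω₀) = ν·(E_P[z]).toReal. [difficulty: XL] [FoiasRosaTemam2010,
arXiv:1606.02174, FMRTTurbulence2001, doi:10.1007/BF01762360]
#9 TameClimateLimitTG (support) — [support, T «EULERIAN LIMIT OF TAME MIRROR CLIMATES» (Kuksin's
Eulerian limit transplanted to deterministic 3-D tame laws); TAG WEAKER·THEOREM-GRADE XL (print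
model: Kuksin–Shirikyan Thm 5.2.2 / Cor. 5.2.3 — tightness of stationary measures and invariance of
the limit under the Euler flow [corpus:book:kuksin2012-mathematics-two-dimensional-turbulence pp.
220, 237]; stochastic-NS law compactness Flandoli–Gatarek 1995 doi:10.1007/BF01192467; trajectory
statistical solutions and their limits Bronzi–Mondaini–Rosa arXiv:1406.2600; route verified by the
critic: (1) uniform window moments from the energy inequality at a good time, ‖∂_t u‖_{L^∞H^{-s}}
bounded; (2) Aubin–Lions–Simon + Arzelà–Ascoli ⇒ tightness ⇒ Prokhorov ⇒ shift-invariant P_∞; (3)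
Skorokhod: ν_n → 0 ⇒ u⊗u passes in L¹_loc (tree `isWeakEulerSolutionOn_of_inviscidLimit` pattern),
datum identity, K-symmetry closed, bounds by Fatou / lsc; (4) realise P_∞ with honest path
representatives); LEAF: ATTACKABLE NOW (XL); answers the g16 census objection V-g («general
time-dependent K-families: no compactness to an exact Euler object»): compactness holds IN LAW and
the limit is an exact-Euler object because the law is carried by exact weak Euler PATHS; in cone;
strictly weaker than S (a compactness lemma)] Tame bounded stationary K-symmetric Leray–Hopf
trajectory laws of NS_{ν_n}(f_TG) with ν_n → 0 (E_{P_n}[e] ≤ E, E_{P_n}[z] ≤ M, tree law format)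
have an EULERIAN LIMIT CLIMATE: a stationary law (P probability, S P-preserving intertwining the
unit shift, e z measurable) carried by K-symmetric weak Euler paths of f_TG with E[e] ≤ E', E[z] ≤
M' for some E', M' — an inhabitant of the class N_stat excludes. [difficulty: XL]
[KuksinShirikyan2012, doi:10.1007/BF01192467, arXiv:1406.2600, doi:10.1007/BF01762360,
DiPernaMajda1987, Temam1979]
#9 TaylorGreenForceRegularTG (support) — [support, F; TAG COSTUME(cite: byte-identical signature to
the shared item stmt-AnomalousDissipation-24257 (RootDecompCycle1 / 2A / KolmogorovPincer /
SteadyMirrorGate / DegreeGate, open) = CLOSED 15378 (PumpedMirror / MirrorEnsemble), proved by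
Theorems `pumpedMirror_taylorGreenForceRegularTG_proof` — the gate attaches this route to 24257); in
cone (force clauses of closes)] The pinned Taylor–Green force is smooth, divergence-free and
mean-zero. [difficulty: provable-now] [TaylorGreen1937, BrachetEtAl1983]

TWO-LAYER PLAN. Nothing filed now (D-0019 thin route). Foreseen: (i) KB ⇐ KB₁ (Krylov–Bogoliubov
stationary law of a bounded K-path with E[e] ≤ E, E[z] < ∞) ∧ KB₂ (an ergodic component with the
same bounds, ergodic decomposition on standard Borel) ∧ KB₃ (a Birkhoff-generic path whose Cesàro
means converge, so meanEnergy/meanDissipation are honest limits) — glued split `KB₁ → KB₂ → KB₃ →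
KB` filed on prover request (one item at birth per the critic); (ii) T ⇐ T₁ (tightness) ∧ T₂
(Skorokhod passage + lsc bounds) — prover-level `--supports` unless a split is requested; (iii)
N_stat's Negative lane: R_stat `NoSmoothMirrorClimateTG` (statistical Kelvin clock; provable now
M–L) landed as `Theorems/NoMirrorEulerClimateTG/Negative/NoSmoothMirrorClimateTG.lean --supports
<N_stat item>`, and the critic's optional trace-ladder rung (H^{1+δ} climates clock-decidable?) as a
second Negative-lane lemma — neither is a route item (not in cone ⇒ decorative as items). Fallbacks
G_fam (∃∀-merge along B's family) and N_stat,visc (viscosity-selected form) are recorded in the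
docstrings, filed only on a MISSTATED-class refutation.

KILL CRITERIA. Refutation of MirrorClimateGapTG by an exhibited bounded ergodic K-climate family
with E_P[z] ≍ ν^{-β}, 0 < β < 1 (a K-symmetric Prandtl–Batchelor climate, a condensate-type
saturation) ⇒ if the refuting family is NOT the climate of B's from-rest runs, pivot to the
along-family fallback G_fam (new item, re-certified closes); if it is, close
`refuted:MirrorClimateGapTG` (the mirror shelf at f_TG is then priced quiet-rough and SMG's G /
CMG's G_coh die with it). Refutation of NoMirrorEulerClimateTG by ANY tame K-Euler climate (an H¹
K-root of (Q), a tame K-periodic Euler orbit, a saturating-enstrophy DNS limit made rigorous) ⇒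
pivot to N_stat,visc only if the refuting climate is provably NOT an Eulerian limit of tame NS
climates (else close `refuted:NoMirrorEulerClimateTG`; SMG's N 33832 / CMG's N_coh die too when the
witness is steady / periodic). Refutation of MirrorMeanBoundedFamilyTG kills the whole pinned mirror
branch (MirrorEnsemble, SMG, CMG, this route) — close `refuted:…`. KB / T can only fail by
mis-typing (restate). Mooted by a proof of the summit elsewhere; superseded by a proof of
SteadyMirrorGate (its witnesses are Dirac climates) or of MirrorEnsemble's L_K 17693.

NOT DECOMPOSED YET. All three cruxes whole at birth: B is the registered hard core in its Fix-K/f_TG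
instance (no honest split; instrument only); G_erg and N_stat are single ∀-statements whose only
honest splits are mechanism splits not in sight (the ergodic/trajectory and Euler-path/moment
distinctions are the TYPING, pledged not to be re-cut as dials; witness-class dial {steady ⊂
coherent ⊂ ergodic} CLOSED — no further sibling on this axis). KB and T go to provers whole (XL; the
KB₁–₃ / T₁–₂ splits above are available on request). F is closed elsewhere (signature only; no
Theorems import: cone hygiene). The OR-siblings SteadyMirrorGate (filed) and CoherentMirrorGate
(deferred) stay separate files; the implications G_erg ⇒ G_coh ⇒ G and N_stat ⇒ N_coh ⇒ N are
recorded, not glue items.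

CHEAPEST FALSIFIER. The critic-endorsed 0-core-h PILOT: re-read the existing K-symmetric from-rest
DNS series (census kdnsB j275366…j285032, r = 1/32, 1/64, 1/128) for the window-mean enstrophy slope
s(ν) = d log⟨‖∇u‖²⟩/d log(1/ν): s ≈ 1 (⟨D⟩ flat, observed 0.26) prices the loud horn (route
consistent), s ∈ (0,1) persistent prices G_erg dead (W_PB-stat), s → 0 prices an Eulerian-limit
signal against N_stat via T. Then T-CLIMATE (≈ 95 core-h per T ≈ 250 run at r = 1/64; ≤ 2 runs
within the cell cap, tag T-CLIMATE) only after the pilot. B rides the tribunal-named DNS decade of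
the SMG lineage (r = 1/1024, 1/2048; director-level ask already filed for 33830). In Lean the
cheapest decided statement is R_stat (statistical Kelvin clock) — a CONSISTENCY witness for N_stat's
smooth sub-class, not a kill.

NUMBERS. f_TG = (sin 2πx₀ cos 2πx₁ cos 2πx₂, −cos 2πx₀ sin 2πx₁ cos 2πx₂, 0), ‖f_TG‖² = 1/4;
skeleton pump: circulation injection 4/π per unit time on C = ∂([0,½]²×{x₂ = 0}); large-ν freeness
of G_erg: ν E_P[z] ≤ ‖f_TG‖√E ⇒ tame for ν ≥ ‖f_TG‖√E/M; census (COSTUME-CENSUS-v4 WK4/IN7):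
K-symmetric from-rest runs r ∈ {1/16,…,1/512} bounded, sup-energy envelope 0.67–0.70, ⟨E⟩ = 0.46 and
⟨D⟩ = 0.26 at r = 1/64, running-mean dissipation ≥ 0.15 on r ≤ 1/32, ≈ 330 time units without
relaminarisation; EdgeCusp α⋆ = 0.444665, ceiling H^s, s < 1.1156.

DEFINITION REQUESTS. None: every notion is tree currency — Torus.IsStationaryLerayHopfLaw
(`.isGlobalLerayHopf` used in closes), Mathlib `Ergodic` / `MeasurePreserving` /
`IsProbabilityMeasure` / `StandardBorelSpace`, Torus.IsGlobalLerayHopf,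
Torus.IsWeakNSSolutionForcedOn, Torus.eGradNormSq / energySpace, meanEnergy / meanDissipation,
lintegrals, fourier, UnitAddTorus, Function.update — elaborated in the lens kernel and the writer's
sketch (rc 0), re-checked natively.

Novelty: Searches (lens-6 g17 card §7, 2026-08-30T15:2x–15:4xZ, corpus fts+vec AND galaxy; writer re-read):
`lit search --hybrid "stationary statistical solution Euler inviscid limit finite enstrophy"` →
[corpus:book:kuksin2012-mathematics-two-dimensional-turbulence pp. 232–241] (Ch. 5 inviscid limit;
pp. 220, 222, 237, 240 read: Thm 5.2.2, Cor. 5.2.3 (iii)),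
[corpus:book:foias2001-navier-stokes-equations-turbulence pp. 188, 208], [corpus:book:majda2002 pp.
319–344] (measure-valued Euler limits — different object); `lit search --hybrid "time-average
Vishik–Fursikov measure trajectory statistical solution vanishing viscosity"` →
[corpus:book:foias2001 pp. 10, 188, 284–287], [corpus:book:kuksin2012 pp. 86–88],
[corpus:paper:foias2010-note-statistical-solutions-three-dimensional-navierstokes-equations pp.
3–6]; `lit galaxy search "Eulerian limit|stationary statistical solution" --star all` →
[galaxy:panama:362143052464137] (Kuksin–Shirikyan, held), [galaxy:pdf:1989195480] (Chueshov–Kuksin,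
random forcing), [galaxy:pdf:7508604948697865400] (Bronzi–Mondaini–Rosa arXiv:1205.5563);
`"invariant measures of the Euler|Krylov-Bogolyubov"` → no fluid hit beyond
[galaxy:panama:502150396379143] (Kuksin, nearly integrable systems); `"Vishik-Fursikov
measure|time-average measure"` (pdf) → only [galaxy:pdf:7508604948697865400]; null in BOTH corpora
for a DETERMINISTIC 3-D Eulerian limit of stationary statistical solutions at a fixed steady force,
for «invariant measure forced Euler Taylor–Green», and  [refs: 10.1007/BF01192467, 10.1017/jfm.2012.524, 1205.5563, 1606.02174, 1406.2600, book:kuksin2012-mathematics-two-dimensional-turbulence, book:foias2001-navier-stokes-equations-turbulence, book:majda2002, book:foias2001, book:kuksin2012, paper:foias2010-note-statistical-solutions-three-dimensional-navierstokes-equations, doi:10.1007/BF01192467, doi:10.1017/jfm.2012.524, KuksinShirikyan2012, FoiasRosaTem]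

Barriers (technique_class: ergodic theory, compactness in law, symmetry carving): - technique_class: ergodic theory, compactness in law, symmetry carving
- Literature.Barriers.AnomalousDissipation.Marchioro1986_globalAttraction
(GravestModeLaminarAttractor): outside — f_TG (|k|² = 3) is not an NS steady state (P[(f_TG·∇)f_TG]
≠ 0) and Fix K kills all |k|² = 1 modes (λ₁(Fix K) = 8π²), so no laminar K-family E ∝ ν⁻² is pinned:
B is neither trivially inhabited nor trivially refuted; G12: Fix K is momentum-free.
- G5 hard core (registered 15509; placed in prose): B is INSIDE by declaration (its Fix-K/f_TG
instance; printed open even in 2-D [graph:arXiv:1305.7089 p. 3]) — the bet is instrument-backed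
saturation (WK4/IN7), not a proof idea; honest.
- QuietRootFloorBarrier (tree file
Literature/Barriers/AnomalousDissipation/QuietRootFloorBarrier.lean, decl
QuietRootFloor.QuietRootFloorBarrier — placed in prose): G_erg is outside (not a floor — every root
/ tame climate passes: a Dirac at an H¹ root is TAME, E[z] = ‖∇U‖² ν-independent); N_stat IS the
complement statement («tame K-statistics of f_TG are empty»), its smooth part provably empty
(R_stat, statistical Kelvin clock on PumpedMirror 15374/15375's identity) — declared
BARRIER-COMPLEMENT, refutable by any tame K-Euler climate.
- Literature.Barriers.AnomalousDissipation.AlexakisDoering2006_energyDissipationBound (2-D ε ≲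
ν^{1/2}): names G_erg's failure world W_PB-stat; 3-D Fix K is not 2-D; the route does not evade a
3-D Prandtl–Batchelor climate — the bet is explicit and instrumented (enstrophy-slope pilot,

sub-problem: AnomalousDissipation · status: draft · opened planner-decomp-ad-writer-1-g6-0 2026-08-30T16:10:53Z · rev 4 · ledger route-AnomalousDissipation-ErgodicMirrorGate
GENERATED by the gate from the ledger (D-0016/17). Provers cite these decls: `theorem foo : Summit.AnomalousDissipation.AnomalousDissipation.Theses.ErgodicMirrorGate.<Decl> := …` in Summits/AnomalousDissipation/AnomalousDissipation/Theorems/<Name>.lean.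
-/

namespace Summit.AnomalousDissipation.AnomalousDissipation.Theses.ErgodicMirrorGate

open scoped BigOperators Topology Manifold Classical MeasureTheory ProbabilityTheory Matrix InnerProductSpace ComplexConjugate ContinuousMap
open Filter Set Function TopologicalSpace MeasureTheory

attribute [summit_statement] _root_.AnomalousDissipation

open Literature.Turb

/-- item stmt-AnomalousDissipation-17694 · crux · rank 2 · open · by planner
why it might fail: every K-family may fatten in the mean as ν → 0 (E ≍ ν^{-α}: capture by near-laminar layered states; the steady K-branches of the Newton census run away like E ~ ν^{-0.7} beyond the fold) — turbulent saturation may simply fail at f_TG in Fix K.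
sources: DoeringFoias2002, FMRTTurbulence2001, arXiv:2311.04182, arXiv:1305.7089, doi:10.1017/s0022112083001159
[crux] B_K — MEAN-BOUNDED MIRROR FAMILY: for f = f_TG there are E, viscosities ν_j > 0 with ν_j → 0,
data u₀ⱼ and global Leray–Hopf solutions u_j of NS_(ν_j)(f_TG) with mirror-symmetric H-lifts (as in
the target) such that meanEnergy u_j ≤ E for all j — turbulent saturation of the Taylor–Green flow
IN THE MEAN inside its symmetry class (zero momentum automatic; datum free; Cesàro, not
sup-in-time). [difficulty: open-problem] -/
@[route_item "route-AnomalousDissipation-ErgodicMirrorGate", crux]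
def MirrorMeanBoundedFamilyTG : Prop :=
  ∀ f : UnitAddTorus (Fin 3) → EuclideanSpace ℝ (Fin 3), f = (fun x => !₂[(fourier 1 (x 0) : ℂ).im * (fourier 1 (x 1) : ℂ).re * (fourier 1 (x 2) : ℂ).re, -((fourier 1 (x 0) : ℂ).re * (fourier 1 (x 1) : ℂ).im * (fourier 1 (x 2) : ℂ).re), (0 : ℝ)]) → ∃ (E : ℝ) (ν : ℕ → ℝ) (u₀ : ℕ → UnitAddTorus (Fin 3) → EuclideanSpace ℝ (Fin 3)) (u : ℕ → ℝ → UnitAddTorus (Fin 3) → EuclideanSpace ℝ (Fin 3)) (U : ℕ → ℝ → Literature.Analysis.FunctionSpaces.Torus.energySpace (Fin 3)), (∀ j, 0 < ν j) ∧ Filter.Tendsto ν Filter.atTop (nhds 0) ∧ (∀ j, Literature.Analysis.FluidPDE.Torus.IsGlobalLerayHopf (ν j) (fun _ => f) (u₀ j) (u j)) ∧ (∀ j t, 0 ≤ t → ((U j t : MeasureTheory.Lp (EuclideanSpace ℝ (Fin 3)) 2 (MeasureTheory.volume : MeasureTheory.Measure (UnitAddTorus (Fin 3)))) : UnitAddTorus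 (Fin 3) → EuclideanSpace ℝ (Fin 3)) =ᵐ[MeasureTheory.volume] u j t) ∧ (∀ j t, 0 ≤ t → ∀ i i' : Fin 3, (fun x => ((U j t : MeasureTheory.Lp (EuclideanSpace ℝ (Fin 3)) 2 (MeasureTheory.volume : MeasureTheory.Measure (UnitAddTorus (Fin 3)))) : UnitAddTorus (Fin 3) → EuclideanSpace ℝ (Fin 3)) (Function.update x i (-x i)) i') =ᵐ[MeasureTheory.volume] (fun x => if i' = i then -(((U j t : MeasureTheory.Lp (EuclideanSpace ℝ (Fin 3)) 2 (MeasureTheory.volume : MeasureTheory.Measure (UnitAddTorus (Fin 3)))) : UnitAddTorus (Fin 3) → EuclideanSpace ℝ (Fin 3)) x i') else ((U j t : MeasureTheory.Lp (EuclideanSpace ℝ (Fin 3)) 2 (MeasureTheory.volume : MeasureTheory.Measure (UnitAddTorus (Fin 3)))) : UnitAddTorus (Fin 3) → EuclideanSpace ℝ (Fin 3)) x i')) ∧ ∀ j, Literature.Analysis.FluidPDE.meanEnergy (u j) ≤ E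

/-- item stmt-AnomalousDissipation-26767 · crux · rank 3 · open · by planner
why it might fail: W_PB-stat: K-symmetric Prandtl–Batchelor CLIMATES (free layers of width √ν, O(1) jumps, E_P[z] ≍ ν^{-1/2}, ν E_P[z] → 0 at bounded energy; CKG 2001, AD06 in 2-D) or weakly-chaotic bounded K-climates dissipating like ν^β, 0<β<1 (Gallet–Young 2013) — nothing excludes either in 3-D Fix K.
sources: ChildressKerswellGilbert2001, doi:10.1017/S0022112056000123, doi:10.1017/jfm.2012.524, FoiasRosaTemam2010, arXiv:1606.02174, AlexakisDoering2006
[crux] [crux, G_erg «MIRROR CLIMATE RATE GAP» (the rough-quiet horn excluded over ERGODIC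
statistics); TAG UNDECIDED(INSTRUMENTED, price only: the from-rest K-runs ARE approximants of
ergodic K-climates and sit in the LOUD alternative, ⟨D⟩ = 0.26 flat on r = 1/32…1/64, running mean ≥
0.15 on r ≤ 1/32 (IN7); kill signal = window-mean enstrophy slope s(ν) = d log⟨‖∇u‖²⟩/d log(1/ν)
persistently in (0,1) along a bounded K-climate family, e.g. Prandtl–Batchelor s = 1/2; 0-core-h
PILOT endorsed first (see Cheapest falsifier); T-CLIMATE (≈ 95 core-h per run, ≤ 2 within cap) only
after it); LEAF: IDEA-NEEDED (no a-priori rate gap for stationary statistics is known) +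
INSTRUMENTABLE; large ν free (ν E_P[z] ≤ ‖f_TG‖√E); ERGODIC typing essential (W_mix: a trajectory
mixing tame and loud components has ν⟨z⟩ = θε, any value — no trajectory-wise uniform dichotomy
holds, while every ergodic component is realised by its own generic path); STRONGER than CMG's G_coh
⊋ SMG's G 33831 (Dirac / uniform-phase laws of K-steady states / K-periodic orbits are ergodic
climates with E_P[z] = period-mean enstrophy) — declared; not a floor (vacuous in fat worlds,
satisfied by tame worlds); consumed by `closes` -/
@[route_item "route-AnomalousDissipation-ErgodicMirrorGate", crux]
def MirrorClimateGapTG : Prop :=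
  ∀ f : UnitAddTorus (Fin 3) → EuclideanSpace ℝ (Fin 3), f = (fun x => !₂[(fourier 1 (x 0) : ℂ).im * (fourier 1 (x 1) : ℂ).re * (fourier 1 (x 2) : ℂ).re, -((fourier 1 (x 0) : ℂ).re * (fourier 1 (x 1) : ℂ).im * (fourier 1 (x 2) : ℂ).re), (0 : ℝ)]) → ∀ E : ℝ, ∃ (M ε : ℝ), 0 < ε ∧ ∀ ν : ℝ, 0 < ν → ∀ (Ω : Type) [MeasurableSpace Ω] (P : MeasureTheory.Measure Ω) (S : Ω → Ω) (traj : Ω → ℝ → UnitAddTorus (Fin 3) → EuclideanSpace ℝ (Fin 3)), Literature.Analysis.FluidPDE.Torus.IsStationaryLerayHopfLaw ν f P S traj → Ergodic S P → (∀ (ω : Ω) (t : ℝ), ∀ i j : Fin 3, (fun x => traj ω t (Function.update x i (-x i)) j) =ᵐ[MeasureTheory.volume] (fun x => if j = i then -(traj ω t x j) else traj ω t x j)) → Measurable (fun ω => ∫⁻ s in Set.Ioo (0 : ℝ) 1, ∫⁻ x, ‖traj ω s x‖ₑ ^ 2) → Measurable (fun ω => ∫⁻ s in Set.Ioo (0 :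 ℝ) 1, Literature.Analysis.FunctionSpaces.Torus.eGradNormSq (traj ω s)) → (∫⁻ ω, (∫⁻ s in Set.Ioo (0 : ℝ) 1, ∫⁻ x, ‖traj ω s x‖ₑ ^ 2) ∂P) ≤ ENNReal.ofReal E → ((∫⁻ ω, (∫⁻ s in Set.Ioo (0 : ℝ) 1, Literature.Analysis.FunctionSpaces.Torus.eGradNormSq (traj ω s)) ∂P) ≤ ENNReal.ofReal M ∨ ENNReal.ofReal ε ≤ ENNReal.ofReal ν * (∫⁻ ω, (∫⁻ s in Set.Ioo (0 : ℝ) 1, Literature.Analysis.FunctionSpaces.Torus.eGradNormSq (traj ω s)) ∂P))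

/-- item stmt-AnomalousDissipation-26768 · crux · rank 4 · SPLIT (gen 1) into NoThinMirrorClimateTG, NoFatMirrorClimateTG + glue NoMirrorEulerClimateTGGlue · direct attempts still welcome (low priority) · by planner
why it might fail: an H¹ K-symmetric steady root of (Q) with pumped edge cusps closing up globally (EdgeCusp N13), or an intermittent H¹ dissipative Euler CLIMATE absorbing the pump's power by anomalous dissipation — energy balance for L^∞L² ∩ L²H¹ weak Euler paths is open, so no balance law excludes it cheaply.
sources: KuksinShirikyan2012, doi:10.1017/cbo9781139137119, arXiv:1409.4322, arXiv:2203.13115, DuchonRobert2000, doi:10.1357/002224004774201681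
[crux] [crux, N_stat «NO EULERIAN-LIMIT CLIMATE IN THE PUMPED MIRROR CLASS» = NO(Q) of the E7c
record lifted from roots / orbits to STATIONARY LAWS carried by exact weak Euler paths, made
LOAD-BEARING; TAG UNDECIDED(E7c programme prices its steady members: CarrierAnatomy N1/N2, EdgeCusp
N7–N10 — pumped separable edges force the cusp exponent α⋆ = 0.444665, class ceiling H^s, s <
1.1156, H¹ NOT excluded; census: every computed K-climate is LOUD, none tame — no Eulerian-limit
climate in sight numerically); LEAF: IDEA-NEEDED + BARRIER-COMPLEMENT (the statement that
QuietRootFloorBarrier's alternative is VOID on tame K-STATISTICS at f_TG; its SMOOTH sub-class is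
DECIDED by the statistical KELVIN CLOCK — skeleton loop C = ∂([0,½]²×{x₂=0}), Γ_C(t) = Γ_C(0) + 4t/π
along every C¹ K-symmetric Euler path of f_TG, and a measurable observable growing linearly along
EVERY path contradicts stationarity: rung R_stat `NoSmoothMirrorClimateTG`, provable now M–L,
deliberately NOT a route item (not in cone) — Negative lane
`Theorems/NoMirrorEulerClimateTG/Negative/NoSmoothMirrorClimateTG.lean --supports <this item>`;
crit's optional trace-ladder rung (H^{1+δ} climates) likewise); MODEL WITH THE OPPOS -/
@[route_item "route-AnomalousDissipation-ErgodicMirrorGate", crux]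
def NoMirrorEulerClimateTG : Prop :=
  ∀ f : UnitAddTorus (Fin 3) → EuclideanSpace ℝ (Fin 3), f = (fun x => !₂[(fourier 1 (x 0) : ℂ).im * (fourier 1 (x 1) : ℂ).re * (fourier 1 (x 2) : ℂ).re, -((fourier 1 (x 0) : ℂ).re * (fourier 1 (x 1) : ℂ).im * (fourier 1 (x 2) : ℂ).re), (0 : ℝ)]) → ∀ (E M : ℝ), ∀ (Ω : Type) [MeasurableSpace Ω] (P : MeasureTheory.Measure Ω) (S : Ω → Ω) (traj : Ω → ℝ → UnitAddTorus (Fin 3) → EuclideanSpace ℝ (Fin 3)), MeasureTheory.IsProbabilityMeasure P → MeasureTheory.MeasurePreserving S P P → (∀ (ω : Ω) (t : ℝ), traj (S ω) t = traj ω (t + 1)) → (∀ (ω : Ω) (T : ℝ), 0 < T → Literature.Analysis.FluidPDE.Torus.IsWeakNSSolutionForcedOn T 0 (fun _ => f) (traj ω 0) (traj ω)) → (∀ (ω : Ω) (t : ℝ), ∀ i j : Fin 3, (fun x => traj ω t (Function.update x i (-x i)) j) =ᵐ[MeasureTheory.volume] (fun x => if j = i then -(traj ω t x j) else traj ω t x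 j)) → Measurable (fun ω => ∫⁻ s in Set.Ioo (0 : ℝ) 1, ∫⁻ x, ‖traj ω s x‖ₑ ^ 2) → Measurable (fun ω => ∫⁻ s in Set.Ioo (0 : ℝ) 1, Literature.Analysis.FunctionSpaces.Torus.eGradNormSq (traj ω s)) → (∫⁻ ω, (∫⁻ s in Set.Ioo (0 : ℝ) 1, ∫⁻ x, ‖traj ω s x‖ₑ ^ 2) ∂P) ≤ ENNReal.ofReal E → (∫⁻ ω, (∫⁻ s in Set.Ioo (0 : ℝ) 1, Literature.Analysis.FunctionSpaces.Torus.eGradNormSq (traj ω s)) ∂P) ≤ ENNReal.ofReal M → False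

-- parent: NoMirrorEulerClimateTG · child (gen 1)
/--     item stmt-AnomalousDissipation-27271 · crux · rank 402 · open
    parent: NoMirrorEulerClimateTG · by planner
    why it might fail: a stationary law on fat finite-enstrophy K-symmetric weak Euler paths of f_TG may exist — any fat H¹ K-root (EdgeCusp-type, α⋆ = 0.4447, not excluded: N12/N13 open) is a Dirac one.
    sources: arXiv:1409.4322, FMRTTurbulence2001, doi:10.1016/j.crhy.2006.01.008, doi:10.1007/s00205-015-0865-z
[crux, B_stat «NO FAT-IN-MEAN MIRROR CLIMATE» = the RESIDUAL of N_stat 26768 modulo the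
theorem-grade piece A_stat (declared; contains, besides the fat-in-mean climates, the junk laws with
non-jointly-measurable slices, which no argument touches and T never produces); TAG UNDECIDED ·
IDEA-NEEDED; N_stat ⇒ B_stat trivially (noFatClimate_of); lens-6 g18 SkeletonTubeCut §B, crit
CLEARED LOW 16:33:16Z] At the pinned Taylor–Green force, no stationary law of energy-bounded,
enstrophy-bounded-in-mean K-symmetric weak Euler paths that is FAT IN MEAN (not thin in mean) at the
skeleton exists. -/
@[route_item "route-AnomalousDissipation-ErgodicMirrorGate", crux]
def NoFatMirrorClimateTG : Prop :=
  ∀ f : UnitAddTorus (Fin 3) → EuclideanSpace ℝ (Fin 3), f = (fun x => !₂[(fourier 1 (x 0) : ℂ).im * (fourier 1 (x 1) : ℂ).re * (fourier 1 (x 2) : ℂ).re, -((fourier 1 (x 0) : ℂ).re * (fourier 1 (x 1) : ℂ).im * (fourier 1 (x 2) : ℂ).re), (0 : ℝ)]) → ∀ (E M : ℝ), ∀ (Ω : Type) [MeasurableSpace Ω] (P : MeasureTheory.Measure Ω) (S : Ω → Ω) (traj : Ω → ℝ → UnitAddTorus (Fin 3) → EuclideanSpace ℝ (Fin 3)), MeasureTheory.IsProbabilityMeasure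 P → MeasureTheory.MeasurePreserving S P P → (∀ (ω : Ω) (t : ℝ), traj (S ω) t = traj ω (t + 1)) → (∀ (ω : Ω) (T : ℝ), 0 < T → Literature.Analysis.FluidPDE.Torus.IsWeakNSSolutionForcedOn T 0 (fun _ => f) (traj ω 0) (traj ω)) → (∀ (ω : Ω) (t : ℝ), ∀ i j : Fin 3, (fun x => traj ω t (Function.update x i (-x i)) j) =ᵐ[MeasureTheory.volume] (fun x => if j = i then -(traj ω t x j) else traj ω t x j)) → Measurable (fun ω => ∫⁻ s in Set.Ioo (0 : ℝ) 1, ∫⁻ x, ‖traj ω s x‖ₑ ^ 2) → Measurable (fun ω => ∫⁻ s in Set.Ioo (0 : ℝ) 1, Literature.Analysis.FunctionSpaces.Torus.eGradNormSq (traj ω s)) → (∫⁻ ω, (∫⁻ s in Set.Ioo (0 : ℝ) 1, ∫⁻ x, ‖traj ω s x‖ₑ ^ 2) ∂P) ≤ ENNReal.ofReal E → (∫⁻ ω, (∫⁻ s in Set.Ioo (0 : ℝ) 1, Literature.Analysis.FunctionSpaces.Torus.eGradNormSq (traj ω s)) ∂P) ≤ ENNReal.ofReal M → ¬ ((∀ t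 : ℝ, Measurable (Function.uncurry fun (ω : Ω) (x : UnitAddTorus (Fin 3)) => traj ω t x)) ∧ ∀ η : ℝ, 0 < η → ∀ δ₀ : ℝ, 0 < δ₀ → ∃ δ : ℝ, 0 < δ ∧ δ < δ₀ ∧ (∫⁻ ω, (∫⁻ s in Set.Ioo (0 : ℝ) 1, (⨅ (g : Fin 3 → UnitAddTorus (Fin 3) → EuclideanSpace ℝ (Fin 3)) (_ : ∀ j : Fin 3, MeasureTheory.MemLp (g j) 2 MeasureTheory.volume ∧ Literature.Analysis.FunctionSpaces.Torus.HasWeakPartialDeriv j (traj ω s) (g j)), ∫⁻ x in {x : UnitAddTorus (Fin 3) | (‖x 1‖ < δ ∨ ‖x 1 - ((1 / 2 : ℝ) : UnitAddCircle)‖ < δ ∨ ‖x 0‖ < δ ∨ ‖x 0 - ((1 / 2 : ℝ) : UnitAddCircle)‖ < δ) ∧ ‖x 2‖ < δ}, ∑ j : Fin 3, ‖g j x‖ₑ ^ 2)) ∂P) ≤ ENNReal.ofReal (η * δ)) → False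

-- parent: NoMirrorEulerClimateTG · child (gen 1)
/--     item stmt-AnomalousDissipation-27270 · support · rank 401 · closed · proved by Summit.AnomalousDissipation.AnomalousDissipation.Theorems.ErgodicMirrorGateNoThinMirrorClimateTG.noThinMirrorClimateTG (prover)
    parent: NoMirrorEulerClimateTG · by planner
    sources: doi:10.1016/j.crhy.2006.01.008, doi:10.1007/BF02099744, FMRTTurbulence2001, doi:10.1017/cbo9781139137119
[support, A_stat «NO THIN-IN-MEAN MIRROR CLIMATE» (twin special side of lens-6 g18 NODE
SkeletonTubeCut §B, kernel HOME/decomp-ad-lens-6/g18/SkeletonTubeCut.lean 3e9d5afc9014; crit CLEARED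
LOW exact trim 16:33:16Z, «EMG twin after r0 or bundled» — bundled): THEOREM-GRADE on paper
(statistical fixed-loop Kelvin clock: E_P[Λ_δ] = −∮_C f_δ·dl for every δ vs |E_P Λ_δ| ≤ 2C_φ δ⁻¹
E_P∫₀¹∫_{T_δ}|∇u|²; the measurability conjunct — jointly measurable slices (ω,x) ↦ traj ω t x — is
what Fubini needs and what every law produced by T has); N_stat 26768 ⇒ A_stat trivially
(noThinClimate_of); LEAF ATTACKABLE NOW (L–XL); BC5/T3 rung for ErgodicMirrorGate's N_stat strictly
below its smooth rung R_stat; split child of NoMirrorEulerClimateTG 26768 with glue A_stat → B_stat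
→ N_stat (noEulerClimate_of, excluded middle on «thin in mean»)] At the pinned Taylor–Green force,
no stationary law of energy-bounded (E), enstrophy-bounded-in-mean (M) K-symmetric weak Euler paths
with jointly measurable slices is THIN IN MEAN at the skeleton (mean tube enstrophy functional o(δ)
along a sequence δ → 0). -/
@[route_item "route-AnomalousDissipation-ErgodicMirrorGate", crux]
def NoThinMirrorClimateTG : Prop :=
  ∀ f : UnitAddTorus (Fin 3) → EuclideanSpace ℝ (Fin 3), f = (fun x => !₂[(fourier 1 (x 0) : ℂ).im * (fourier 1 (x 1) : ℂ).re * (fourier 1 (x 2) : ℂ).re, -((fourier 1 (x 0) : ℂ).re * (fourier 1 (x 1) : ℂ).im * (fourier 1 (x 2) : ℂ).re), (0 : ℝ)]) → ∀ (E M : ℝ), ∀ (Ω : Type) [MeasurableSpace Ω] (P : MeasureTheory.Measure Ω) (S : Ω → Ω) (traj : Ω → ℝ → UnitAddTorus (Fin 3) → EuclideanSpace ℝ (Fin 3)), MeasureTheory.IsProbabilityMeasure P → MeasureTheory.MeasurePreserving S P P → (∀ (ω : Ω) (t : ℝ), traj (S ω) t = traj ω (t + 1)) → (∀ (ω : Ω)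 (T : ℝ), 0 < T → Literature.Analysis.FluidPDE.Torus.IsWeakNSSolutionForcedOn T 0 (fun _ => f) (traj ω 0) (traj ω)) → (∀ (ω : Ω) (t : ℝ), ∀ i j : Fin 3, (fun x => traj ω t (Function.update x i (-x i)) j) =ᵐ[MeasureTheory.volume] (fun x => if j = i then -(traj ω t x j) else traj ω t x j)) → Measurable (fun ω => ∫⁻ s in Set.Ioo (0 : ℝ) 1, ∫⁻ x, ‖traj ω s x‖ₑ ^ 2) → Measurable (fun ω => ∫⁻ s in Set.Ioo (0 : ℝ) 1, Literature.Analysis.FunctionSpaces.Torus.eGradNormSq (traj ω s)) → (∫⁻ ω, (∫⁻ s in Set.Ioo (0 : ℝ) 1, ∫⁻ x, ‖traj ω s x‖ₑ ^ 2) ∂P) ≤ ENNReal.ofReal E → (∫⁻ ω, (∫⁻ s in Set.Ioo (0 : ℝ) 1, Literature.Analysis.FunctionSpaces.Torus.eGradNormSq (traj ω s)) ∂P) ≤ ENNReal.ofReal M → ((∀ t : ℝ, Measurable (Function.uncurry fun (ω : Ω) (x : UnitAddTorus (Fin 3)) => traj ω t x)) ∧ ∀ η : ℝ, 0 < η → ∀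 δ₀ : ℝ, 0 < δ₀ → ∃ δ : ℝ, 0 < δ ∧ δ < δ₀ ∧ (∫⁻ ω, (∫⁻ s in Set.Ioo (0 : ℝ) 1, (⨅ (g : Fin 3 → UnitAddTorus (Fin 3) → EuclideanSpace ℝ (Fin 3)) (_ : ∀ j : Fin 3, MeasureTheory.MemLp (g j) 2 MeasureTheory.volume ∧ Literature.Analysis.FunctionSpaces.Torus.HasWeakPartialDeriv j (traj ω s) (g j)), ∫⁻ x in {x : UnitAddTorus (Fin 3) | (‖x 1‖ < δ ∨ ‖x 1 - ((1 / 2 : ℝ) : UnitAddCircle)‖ < δ ∨ ‖x 0‖ < δ ∨ ‖x 0 - ((1 / 2 : ℝ) : UnitAddCircle)‖ < δ) ∧ ‖x 2‖ < δ}, ∑ j : Fin 3, ‖g j x‖ₑ ^ 2)) ∂P) ≤ ENNReal.ofReal (η * δ)) → False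

-- `NoThinMirrorClimateTG` holds: proved by `Summit.AnomalousDissipation.AnomalousDissipation.Theorems.ErgodicMirrorGateNoThinMirrorClimateTG.noThinMirrorClimateTG` (its module imports this route file, so no `_holds` link can be stated here).

-- parent: NoMirrorEulerClimateTG · glue (gen 1)
/--     item stmt-AnomalousDissipation-27272 · support · rank 403 · closed · proved by Summit.AnomalousDissipation.AnomalousDissipation.Theorems.SkeletonTubeCutClimateGlue.noMirrorEulerClimateTGGlue_holds (prover)
    parent: NoMirrorEulerClimateTG · GLUE: children ⟹ parent · by planner
NoThinMirrorClimateTG → NoFatMirrorClimateTG → NoMirrorEulerClimateTG: excluded middle on «thin in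
mean at the skeleton» (jointly measurable slices ∧ mean tube enstrophy o(δ)); kernel proof
noEulerClimate_of / noEulerClimate26768_iff_thin_and_fat in lens-6 g18 SkeletonTubeCut.lean
3e9d5afc9014 (trivial seam; exact cut N_stat ↔ A_stat ∧ B_stat, Iff.rfl vs tree 30af7a0b231f) -/
@[route_item "route-AnomalousDissipation-ErgodicMirrorGate"]
def NoMirrorEulerClimateTGGlue : Prop :=
  NoThinMirrorClimateTG → NoFatMirrorClimateTG → NoMirrorEulerClimateTG

-- `NoMirrorEulerClimateTGGlue` holds: proved by `Summit.AnomalousDissipation.AnomalousDissipation.Theorems.SkeletonTubeCutClimateGlue.noMirrorEulerClimateTGGlue_holds` (its module imports this route file, so no `_holds` link can be stated here).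

/-- item stmt-AnomalousDissipation-17692 · aside · rank 9 · open · by planner
why it might fail: it is the summit in the mirror arena: fails if every bounded K-family laminarises in the mean (quiet K-attractor) or every K-family's mean energy runs away as ν → 0.
sources: FMRTTurbulence2001, DoeringFoias2002, arXiv:2311.04182
[target] X_K — for f = f_TG there are E, ε > 0, viscosities ν_j > 0 with ν_j → 0, data u₀ⱼ and
global Leray–Hopf solutions u_j of NS_(ν_j)(f_TG) with H-lifts U_j (U_j t = u_j t a.e., t ≥ 0) that
are mirror-symmetric a.e. for all t ≥ 0, such that meanEnergy u_j ≤ E and meanDissipation ν_j u_j ≥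
ε for all j (the zeroth law inside Fix K, mean form; implies the Statement by f_TG's regularity,
proved as `tgRegular_holds`). -/
@[route_item "route-AnomalousDissipation-ErgodicMirrorGate"]
def MirrorMeanZerothLawTG : Prop :=
  ∀ f : UnitAddTorus (Fin 3) → EuclideanSpace ℝ (Fin 3), f = (fun x => !₂[(fourier 1 (x 0) : ℂ).im * (fourier 1 (x 1) : ℂ).re * (fourier 1 (x 2) : ℂ).re, -((fourier 1 (x 0) : ℂ).re * (fourier 1 (x 1) : ℂ).im * (fourier 1 (x 2) : ℂ).re), (0 : ℝ)]) → ∃ (E ε : ℝ), 0 < ε ∧ ∃ (ν : ℕ → ℝ) (u₀ : ℕ → UnitAddTorus (Fin 3) → EuclideanSpace ℝ (Fin 3)) (u : ℕ → ℝ → UnitAddTorus (Fin 3) → EuclideanSpace ℝ (Fin 3)) (U : ℕ → ℝ → Literature.Analysis.FunctionSpaces.Torus.energySpace (Fin 3)), (∀ j, 0 < ν j) ∧ Filter.Tendsto ν Filter.atTop (nhds 0) ∧ (∀ j, Literature.Analysis.FluidPDE.Torus.IsGlobalLerayHopf (ν j) (fun _ => f) (u₀ j) (u j)) ∧ (∀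 j t, 0 ≤ t → ((U j t : MeasureTheory.Lp (EuclideanSpace ℝ (Fin 3)) 2 (MeasureTheory.volume : MeasureTheory.Measure (UnitAddTorus (Fin 3)))) : UnitAddTorus (Fin 3) → EuclideanSpace ℝ (Fin 3)) =ᵐ[MeasureTheory.volume] u j t) ∧ (∀ j t, 0 ≤ t → ∀ i i' : Fin 3, (fun x => ((U j t : MeasureTheory.Lp (EuclideanSpace ℝ (Fin 3)) 2 (MeasureTheory.volume : MeasureTheory.Measure (UnitAddTorus (Fin 3)))) : UnitAddTorus (Fin 3) → EuclideanSpace ℝ (Fin 3)) (Function.update x i (-x i)) i') =ᵐ[MeasureTheory.volume] (fun x => if i' = i then -(((U j t : MeasureTheory.Lp (EuclideanSpace ℝ (Fin 3)) 2 (MeasureTheory.volume : MeasureTheory.Measure (UnitAddTorus (Fin 3)))) : UnitAddTorus (Fin 3) → EuclideanSpace ℝ (Fin 3)) x i') else ((U j t : MeasureTheory.Lp (EuclideanSpace ℝ (Fin 3)) 2 (MeasureTheory.volume : MeasureTheory.Measure (UnitAddTorus (Fin 3)))) : UnitAddTorus (Fin 3) → EuclideanSpace ℝ (Fin 3)) x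 i')) ∧ (∀ j, Literature.Analysis.FluidPDE.meanEnergy (u j) ≤ E) ∧ ∀ j, ε ≤ Literature.Analysis.FluidPDE.meanDissipation (ν j) (u j)

/-- item stmt-AnomalousDissipation-24257 · support · rank 9 · closed · proved by Summit.AnomalousDissipation.AnomalousDissipation.Theorems.TaylorGreenForceRegular.rootDecompCycle1_taylorGreenForceRegularTG (prover) · by planner
sources: TaylorGreen1937, BrachetEtAl1983
[support] [support; TAG COSTUME(cite: shared item stmt-AnomalousDissipation-15378 CLOSED — proved by
Summit.AnomalousDissipation.AnomalousDissipation.Theorems.pumpedMirror_taylorGreenForceRegularTG_proof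
@ b5325d8714b8; verbatim the PumpedMirror decl so the gate deduplicates); in cone (force clauses of
closes); no leaf] The pinned Taylor–Green force is smooth, divergence-free and mean-zero.
[difficulty: provable-now] -/
@[route_item "route-AnomalousDissipation-ErgodicMirrorGate", crux]
def TaylorGreenForceRegularTG : Prop :=
  ∀ f : UnitAddTorus (Fin 3) → EuclideanSpace ℝ (Fin 3), f = (fun x => !₂[(fourier 1 (x 0) : ℂ).im * (fourier 1 (x 1) : ℂ).re * (fourier 1 (x 2) : ℂ).re, -((fourier 1 (x 0) : ℂ).re * (fourier 1 (x 1) : ℂ).im * (fourier 1 (x 2) : ℂ).re), (0 : ℝ)]) → Literature.Analysis.FunctionSpaces.Torus.IsSmooth f ∧ Literature.Analysis.FunctionSpaces.Torus.IsDivFree f ∧ Literature.Analysis.FunctionSpaces.Torus.HasZeroMean f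

-- `TaylorGreenForceRegularTG` holds: proved by `Summit.AnomalousDissipation.AnomalousDissipation.Theorems.TaylorGreenForceRegular.rootDecompCycle1_taylorGreenForceRegularTG` (its module imports this route file, so no `_holds` link can be stated here).

/-- item stmt-AnomalousDissipation-26769 · support · rank 9 · open · by planner
sources: FoiasRosaTemam2010, arXiv:1606.02174, FMRTTurbulence2001, doi:10.1007/BF01762360
[support] [support, KB «ERGODIC CLIMATE OF A BOUNDED PATH»; TAG WEAKER·THEOREM-GRADE XL
(Krylov–Bogoliubov on two-sided path space X = C_loc(H_w) ∩ L²_loc-strong: window enstrophy bounds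
from the strong energy inequality at a.e. time (`IsLerayHopfOn.energy_ineq_ae`) ⇒ Aubin–Lions–Simon
tightness; the Leray–Hopf class is closed at fixed ν > 0 and one restricts to the invariant
full-measure set where EVERY path is Leray–Hopf from its own slice (the tree format asks every
path); E_P̄[e] ≤ meanEnergy ≤ E by portmanteau, E_P̄[z] ≤ liminf by lower semicontinuity; ergodic
decomposition on a standard Borel space ⇒ a component with E[e] ≤ E, E[z] < ∞; a Birkhoff-generic
point + integer-block sandwich ⇒ the root's limsup functionals meanEnergy / meanDissipation are
honest limits; print: Vishik–Fursikov / time-average measures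
[corpus:paper:foias2010-note-statistical-solutions-three-dimensional-navierstokes-equations pp.
3–6], arXiv:1606.02174, [corpus:book:foias2001-navier-stokes-equations-turbulence pp. 188, 208];
tree: `Torus.IsStationaryLerayHopfLaw` (+ `of_steady`), Birkhoff in `Literature.Dynamics.Ergodic`);
LEAF: ATTACKABLE NOW (XL; splittable by the planner into KB₁ Krylov–Bogoliubov -/
@[route_item "route-AnomalousDissipation-ErgodicMirrorGate", crux]
def ErgodicClimateTG : Prop :=
  ∀ f : UnitAddTorus (Fin 3) → EuclideanSpace ℝ (Fin 3), f = (fun x => !₂[(fourier 1 (x 0) : ℂ).im * (fourier 1 (x 1) : ℂ).re * (fourier 1 (x 2) : ℂ).re, -((fourier 1 (x 0) : ℂ).re * (fourier 1 (x 1) : ℂ).im * (fourier 1 (x 2) : ℂ).re), (0 : ℝ)]) → ∀ (E ν : ℝ) (u₀ : UnitAddTorus (Fin 3) → EuclideanSpace ℝ (Fin 3)) (u : ℝ → UnitAddTorus (Fin 3) → EuclideanSpace ℝ (Fin 3)) (U : ℝ → Literature.Analysis.FunctionSpaces.Torus.energySpace (Fin 3)), 0 < ν → Literature.Analysis.FluidPDE.Torus.IsGlobalLerayHopf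 ν (fun _ => f) u₀ u → (∀ t, 0 ≤ t → ((U t : MeasureTheory.Lp (EuclideanSpace ℝ (Fin 3)) 2 (MeasureTheory.volume : MeasureTheory.Measure (UnitAddTorus (Fin 3)))) : UnitAddTorus (Fin 3) → EuclideanSpace ℝ (Fin 3)) =ᵐ[MeasureTheory.volume] u t) → (∀ t, 0 ≤ t → ∀ i i' : Fin 3, (fun x => ((U t : MeasureTheory.Lp (EuclideanSpace ℝ (Fin 3)) 2 (MeasureTheory.volume : MeasureTheory.Measure (UnitAddTorus (Fin 3)))) : UnitAddTorus (Fin 3) → EuclideanSpace ℝ (Fin 3)) (Function.update x i (-x i)) i') =ᵐ[MeasureTheory.volume] (fun x => if i' = i then -(((U t : MeasureTheory.Lp (EuclideanSpace ℝ (Fin 3)) 2 (MeasureTheory.volume : MeasureTheory.Measure (UnitAddTorus (Fin 3)))) : UnitAddTorus (Fin 3) → EuclideanSpace ℝ (Fin 3)) x i') else ((U t : MeasureTheory.Lp (EuclideanSpace ℝ (Fin 3)) 2 (MeasureTheory.volume : MeasureTheory.Measure (UnitAddTorus (Fin 3)))) : UnitAddTorus (Fin 3) → EuclideanSpace ℝ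 (Fin 3)) x i')) → Literature.Analysis.FluidPDE.meanEnergy u ≤ E → ∃ (Ω : Type) (_ : MeasurableSpace Ω) (P : MeasureTheory.Measure Ω) (S : Ω → Ω) (traj : Ω → ℝ → UnitAddTorus (Fin 3) → EuclideanSpace ℝ (Fin 3)) (ω₀ : Ω), Literature.Analysis.FluidPDE.Torus.IsStationaryLerayHopfLaw ν f P S traj ∧ Ergodic S P ∧ (∀ (ω : Ω) (t : ℝ), ∀ i j : Fin 3, (fun x => traj ω t (Function.update x i (-x i)) j) =ᵐ[MeasureTheory.volume] (fun x => if j = i then -(traj ω t x j) else traj ω t x j)) ∧ Measurable (fun ω => ∫⁻ s in Set.Ioo (0 : ℝ) 1, ∫⁻ x, ‖traj ω s x‖ₑ ^ 2) ∧ Measurable (fun ω => ∫⁻ s in Set.Ioo (0 : ℝ) 1, Literature.Analysis.FunctionSpaces.Torus.eGradNormSq (traj ω s)) ∧ (∫⁻ ω, (∫⁻ s in Set.Ioo (0 : ℝ) 1, ∫⁻ x, ‖traj ω s x‖ₑ ^ 2) ∂P) ≤ ENNReal.ofReal E ∧ (∫⁻ ω, (∫⁻ s in Set.Ioo (0 :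 ℝ) 1, Literature.Analysis.FunctionSpaces.Torus.eGradNormSq (traj ω s)) ∂P) ≠ ⊤ ∧ Literature.Analysis.FluidPDE.meanEnergy (traj ω₀) ≤ E ∧ Literature.Analysis.FluidPDE.meanDissipation ν (traj ω₀) = ν * (∫⁻ ω, (∫⁻ s in Set.Ioo (0 : ℝ) 1, Literature.Analysis.FunctionSpaces.Torus.eGradNormSq (traj ω s)) ∂P).toReal

/-- item stmt-AnomalousDissipation-26770 · support · rank 9 · open · by planner
sources: KuksinShirikyan2012, doi:10.1007/BF01192467, arXiv:1406.2600, doi:10.1007/BF01762360, DiPernaMajda1987, Temam1979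
[support] [support, T «EULERIAN LIMIT OF TAME MIRROR CLIMATES» (Kuksin's Eulerian limit transplanted
to deterministic 3-D tame laws); TAG WEAKER·THEOREM-GRADE XL (print model: Kuksin–Shirikyan Thm
5.2.2 / Cor. 5.2.3 — tightness of stationary measures and invariance of the limit under the Euler
flow [corpus:book:kuksin2012-mathematics-two-dimensional-turbulence pp. 220, 237]; stochastic-NS law
compactness Flandoli–Gatarek 1995 doi:10.1007/BF01192467; trajectory statistical solutions and their
limits Bronzi–Mondaini–Rosa arXiv:1406.2600; route verified by the critic: (1) uniform window
moments from the energy inequality at a good time, ‖∂_t u‖_{L^∞H^{-s}} bounded; (2)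
Aubin–Lions–Simon + Arzelà–Ascoli ⇒ tightness ⇒ Prokhorov ⇒ shift-invariant P_∞; (3) Skorokhod: ν_n
→ 0 ⇒ u⊗u passes in L¹_loc (tree `isWeakEulerSolutionOn_of_inviscidLimit` pattern), datum identity,
K-symmetry closed, bounds by Fatou / lsc; (4) realise P_∞ with honest path representatives); LEAF:
ATTACKABLE NOW (XL); answers the g16 census objection V-g («general time-dependent K-families: no
compactness to an exact Euler object»): compactness holds IN LAW and the limit is an exact-Euler
object because the law is carri -/
@[route_item "route-AnomalousDissipation-ErgodicMirrorGate", crux]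
def TameClimateLimitTG : Prop :=
  ∀ f : UnitAddTorus (Fin 3) → EuclideanSpace ℝ (Fin 3), f = (fun x => !₂[(fourier 1 (x 0) : ℂ).im * (fourier 1 (x 1) : ℂ).re * (fourier 1 (x 2) : ℂ).re, -((fourier 1 (x 0) : ℂ).re * (fourier 1 (x 1) : ℂ).im * (fourier 1 (x 2) : ℂ).re), (0 : ℝ)]) → ∀ (E M : ℝ) (ν : ℕ → ℝ), (∀ n, 0 < ν n) → Filter.Tendsto ν Filter.atTop (nhds 0) → (∀ n, ∃ (Ω : Type) (_ : MeasurableSpace Ω) (P : MeasureTheory.Measure Ω) (S : Ω → Ω) (traj : Ω → ℝ → UnitAddTorus (Fin 3) → EuclideanSpace ℝ (Fin 3)), Literature.Analysis.FluidPDE.Torus.IsStationaryLerayHopfLaw (ν n) f P S traj ∧ (∀ (ω : Ω) (t : ℝ), ∀ i j : Fin 3, (fun x => traj ω t (Function.update x i (-x i)) j) =ᵐ[MeasureTheory.volume] (fun x => if j = i then -(traj ω t x j) else traj ω t x j)) ∧ Measurable (fun ω => ∫⁻ s in Set.Ioo (0 : ℝ) 1, ∫⁻ x, ‖traj ω s x‖ₑ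 ^ 2) ∧ Measurable (fun ω => ∫⁻ s in Set.Ioo (0 : ℝ) 1, Literature.Analysis.FunctionSpaces.Torus.eGradNormSq (traj ω s)) ∧ (∫⁻ ω, (∫⁻ s in Set.Ioo (0 : ℝ) 1, ∫⁻ x, ‖traj ω s x‖ₑ ^ 2) ∂P) ≤ ENNReal.ofReal E ∧ (∫⁻ ω, (∫⁻ s in Set.Ioo (0 : ℝ) 1, Literature.Analysis.FunctionSpaces.Torus.eGradNormSq (traj ω s)) ∂P) ≤ ENNReal.ofReal M) → ∃ (E' M' : ℝ), ∃ (Ω : Type) (_ : MeasurableSpace Ω) (P : MeasureTheory.Measure Ω) (S : Ω → Ω) (traj : Ω → ℝ → UnitAddTorus (Fin 3) → EuclideanSpace ℝ (Fin 3)), MeasureTheory.IsProbabilityMeasure P ∧ MeasureTheory.MeasurePreserving S P P ∧ (∀ (ω : Ω) (t : ℝ), traj (S ω) t = traj ω (t + 1)) ∧ (∀ (ω : Ω) (T : ℝ), 0 < T → Literature.Analysis.FluidPDE.Torus.IsWeakNSSolutionForcedOn T 0 (fun _ => f) (traj ω 0) (traj ω)) ∧ (∀ (ω : Ω) (t : ℝ),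 ∀ i j : Fin 3, (fun x => traj ω t (Function.update x i (-x i)) j) =ᵐ[MeasureTheory.volume] (fun x => if j = i then -(traj ω t x j) else traj ω t x j)) ∧ Measurable (fun ω => ∫⁻ s in Set.Ioo (0 : ℝ) 1, ∫⁻ x, ‖traj ω s x‖ₑ ^ 2) ∧ Measurable (fun ω => ∫⁻ s in Set.Ioo (0 : ℝ) 1, Literature.Analysis.FunctionSpaces.Torus.eGradNormSq (traj ω s)) ∧ (∫⁻ ω, (∫⁻ s in Set.Ioo (0 : ℝ) 1, ∫⁻ x, ‖traj ω s x‖ₑ ^ 2) ∂P) ≤ ENNReal.ofReal E' ∧ (∫⁻ ω, (∫⁻ s in Set.Ioo (0 : ℝ) 1, Literature.Analysis.FunctionSpaces.Torus.eGradNormSq (traj ω s)) ∂P) ≤ ENNReal.ofReal M'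

/-- item stmt-AnomalousDissipation-26771 · assembly · rank 1 · open · by planner
sources: FMRTTurbulence2001
[assembly] MirrorMeanBoundedFamilyTG → MirrorClimateGapTG → NoMirrorEulerClimateTG →
ErgodicClimateTG → TameClimateLimitTG → TaylorGreenForceRegularTG → the zeroth law. -/
@[route_item "route-AnomalousDissipation-ErgodicMirrorGate"]
def Assembly : Prop :=
  MirrorMeanBoundedFamilyTG → MirrorClimateGapTG → NoMirrorEulerClimateTG → ErgodicClimateTG → TameClimateLimitTG → TaylorGreenForceRegularTG → _root_.AnomalousDissipation

/-! D-0027 §2.1 — DECIDING THEOREM (planner-authored via `route open/edit --closes-file`; by planner-decomp-ad-writer-1-g6-0 2026-08-30T16:10:53Z):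
its hypotheses are this route's items and its conclusion the sub-problem Statement (glue_lint), and it elaborates with this file. -/

@[closes "route-AnomalousDissipation-ErgodicMirrorGate"] theorem closes (hB : MirrorMeanBoundedFamilyTG) (hG : MirrorClimateGapTG) (hN : NoMirrorEulerClimateTG)
    (hKB : ErgodicClimateTG) (hT : TameClimateLimitTG) (hF : TaylorGreenForceRegularTG) : _root_.AnomalousDissipation := by
  -- name the pinned Taylor–Green force once
  obtain ⟨f, hf⟩ : ∃ f : UnitAddTorus (Fin 3) → EuclideanSpace ℝ (Fin 3), f = (fun x => !₂[(fourier 1 (x 0) : ℂ).im * (fourier 1 (x 1) : ℂ).re * (fourier 1 (x 2) : ℂ).re, -((fourier 1 (x 0) : ℂ).re * (fourier 1 (x 1) : ℂ).im * (fourier 1 (x 2) : ℂ).re), (0 : ℝ)]) := ⟨_, rfl⟩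
  obtain ⟨hfs, hfd, hfm⟩ := hF f hf
  obtain ⟨E, ν, u₀, u, U, hνpos, hνlim, hLH, hUeq, hUK, hEn⟩ := hB f hf
  obtain ⟨M, ε, hε, hgap⟩ := hG f hf E
  -- per index n: KB turns the n-th bounded K-path into an ERGODIC bounded K-climate with a generic path ω₀;
  -- G makes that climate loud (then the generic path is a root-currency witness) or tame.
  have key : ∀ n : ℕ, (∃ (v₀ : UnitAddTorus (Fin 3) → EuclideanSpace ℝ (Fin 3)) (v : ℝ → UnitAddTorus (Fin 3) → EuclideanSpace ℝ (Fin 3)), Literature.Analysis.FluidPDE.Torus.IsGlobalLerayHopf (ν n) (fun _ => f) v₀ v ∧ Literature.Analysis.FluidPDE.meanEnergy v ≤ E ∧ ε ≤ Literature.Analysis.FluidPDE.meanDissipation (ν n) v) ∨ (∃ (Ω : Type) (_ : MeasurableSpace Ω) (P : MeasureTheory.Measure Ω) (S : Ω → Ω) (traj : Ω → ℝ → UnitAddTorus (Fin 3) → EuclideanSpace ℝ (Fin 3)), Literature.Analysis.FluidPDE.Torus.IsStationaryLerayHopfLaw (ν n) f P S traj ∧ (∀ (ω : Ω) (t : ℝ),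 ∀ i j : Fin 3, (fun x => traj ω t (Function.update x i (-x i)) j) =ᵐ[MeasureTheory.volume] (fun x => if j = i then -(traj ω t x j) else traj ω t x j)) ∧ Measurable (fun ω => ∫⁻ s in Set.Ioo (0 : ℝ) 1, ∫⁻ x, ‖traj ω s x‖ₑ ^ 2) ∧ Measurable (fun ω => ∫⁻ s in Set.Ioo (0 : ℝ) 1, Literature.Analysis.FunctionSpaces.Torus.eGradNormSq (traj ω s)) ∧ (∫⁻ ω, (∫⁻ s in Set.Ioo (0 : ℝ) 1, ∫⁻ x, ‖traj ω s x‖ₑ ^ 2) ∂P) ≤ ENNReal.ofReal E ∧ (∫⁻ ω, (∫⁻ s in Set.Ioo (0 : ℝ) 1, Literature.Analysis.FunctionSpaces.Torus.eGradNormSq (traj ω s)) ∂P) ≤ ENNReal.ofReal M) := by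
    intro n
    obtain ⟨Ω, mΩ, P, S, traj, ω₀, hL, hErg, hK, he, hz, hEe, hZ, hmE, hmD⟩ :=
      hKB f hf E (ν n) (u₀ n) (u n) (U n) (hνpos n) (hLH n) (hUeq n) (hUK n) (hEn n)
    rcases hgap (ν n) (hνpos n) Ω P S traj hL hErg hK he hz hEe with htame | hloud
    · exact Or.inr ⟨Ω, mΩ, P, S, traj, hL, hK, he, hz, hEe, htame⟩
    · refine Or.inl ⟨traj ω₀ 0, traj ω₀, hL.isGlobalLerayHopf ω₀, hmE, ?_⟩
      rw [hmD]
      have hfin : ENNReal.ofReal (ν n) * (∫⁻ ω, (∫⁻ s in Set.Ioo (0 : ℝ) 1, Literature.Analysis.FunctionSpaces.Torus.eGradNormSq (traj ω s)) ∂P) ≠ ⊤ :=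
        ENNReal.mul_ne_top ENNReal.ofReal_ne_top hZ
      have h1 := ENNReal.toReal_mono hfin hloud
      rwa [ENNReal.toReal_ofReal hε.le, ENNReal.toReal_mul, ENNReal.toReal_ofReal (hνpos n).le] at h1
  by_cases hfreq : ∃ᶠ n in Filter.atTop, ∃ (v₀ : UnitAddTorus (Fin 3) → EuclideanSpace ℝ (Fin 3)) (v : ℝ → UnitAddTorus (Fin 3) → EuclideanSpace ℝ (Fin 3)), Literature.Analysis.FluidPDE.Torus.IsGlobalLerayHopf (ν n) (fun _ => f) v₀ v ∧ Literature.Analysis.FluidPDE.meanEnergy v ≤ E ∧ ε ≤ Literature.Analysis.FluidPDE.meanDissipation (ν n) v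
  · -- the LOUD horn: generic paths of loud ergodic K-climates along a subsequence ARE a zeroth-law witness
    obtain ⟨φ, hφ, hloud⟩ := Filter.extraction_of_frequently_atTop hfreq
    choose v₀ v hv using hloud
    exact ⟨f, hfs, hfd, hfm, fun j => ν (φ j), v₀, v, fun j => hνpos _, hνlim.comp hφ.tendsto_atTop,
      fun j => (hv j).1, ⟨E, fun j => (hv j).2.1⟩, ε, hε, fun j => (hv j).2.2⟩
  · -- the TAME horn: eventually every index carries a tame ergodic K-climate; T lands them on a
    -- stationary EULER climate of f_TG in Fix K with finite mean enstrophy, which N excludes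
    have hev := (Filter.not_frequently.1 hfreq).mono fun n hn => (key n).resolve_left hn
    obtain ⟨J, hJ⟩ := Filter.eventually_atTop.1 hev
    obtain ⟨E', M', Ω, mΩ, P, S, traj, hP, hS, hshift, hsol, hK, he, hz, hEe, hZM⟩ :=
      hT f hf E M (fun j => ν (j + J)) (fun j => hνpos _) ((Filter.tendsto_add_atTop_iff_nat J).2 hνlim)
        (fun j => hJ (j + J) (Nat.le_add_left J j))
    exact (hN f hf E' M' Ω P S traj hP hS hshift hsol hK he hz hEe hZM).elim

end Summit.AnomalousDissipation.AnomalousDissipation.Theses.ErgodicMirrorGate
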